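import Summits.ValiantsHypothesis.ValiantsHypothesis.Theorems.LacunarySymmetroidMatrixDescartesPivotTangencyLaw

/-!
# `MatrixDescartes` census — DEFLATION NESTING for `2 × 2` pivot pencils (pivot column, m = 2)

HONEST FRAMING.  Structure lemmas for the object-search cell `pub-symmetroid`'s pivot column
(`…CensusPivotDefs`: `pivotPosRoots`, `PivotRootLawAt`; the open m = 2 row «(2,K) ≤ 2K», located cell
(2,4)₁ ∈ {8,9,10}).  Landed `--supports stmt-ValiantsHypothesis-18050` as a helper; it proves NO bound on any
pivot row and says nothing about `Theses.LacunarySymmetroid.MatrixDescartes`, DoorA26/DoorA34, the census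
registers or `VP ≠ VNP`.

THE DEFLATION.  For `F(X) = X^e • J + ∑ₖ X^{d k} • P k` and a letter `i₀` of MAXIMAL exponent `d i₀ > e`, the
Euler operator kills that letter while keeping the pencil shape:
`(X ∂_X − d i₀) F = −(d i₀ − e) · F̃` with `F̃(X) = X^e • J + ∑ₖ ((d i₀ − d k)/(d i₀ − e)) X^{d k} • P k`
(non-negative rescaling of the other letters, the pivot term FIXED, the letter `i₀` gone) — the TOP DEFLATION; the
letter of minimal exponent `d i₀ < e` gives the BOTTOM DEFLATION `X^e • J + ∑ₖ ((d k − d i₀)/(e − d i₀)) X^{d k} • P k`.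
In the scalar normal form of `…CensusPivotTwoEnvelope` (envelope `Λ_K`, roots `Λ_K = 1`, islands `{Λ_K < 1}` =
`{det F < 0}`) the deflations satisfy `Λ̃^top ≤ Λ_K − Λ_K'/b`, `Λ̃^bot ≤ Λ_K + Λ_K'/|b|` (envelope of the deflated
pencil against the Euler derivative of the envelope).  This file proves the kernel form of these inequalities AT
THE ROOTS, for `J` symmetric with a strictly positive direction and all `P k ⪰ 0`:

* `det_deflateTop_neg_of_upcrossing`: at a positive root of `det F` where `det F` is strictly increasing (the
  RIGHT end of an island) the top-deflated pencil has `det F̃(u₀) < 0` — every up-crossing of the `K`-letter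
  pencil lies inside an island of its `(K−1)`-letter top deflation;
* `det_deflateBot_neg_of_downcrossing`: at a positive root where `det F` is strictly decreasing (the LEFT end of
  an island) the bottom-deflated pencil has negative determinant.

So the islands of a `K`-letter pencil are NESTED in those of its deflations end by end — the first step of a
Rolle/deflation induction for the m = 2 row (the missing step: bound the re-entries of ONE deflated island; the
g5 (2,4) eight-root pencil has a one-island top deflation entered four times).  Tools: Jacobi's formula on the
kernel vector (`trace_mul_quadForm_deriv_eq`), `trace_pos_at_root`, `2 × 2` definiteness algebra.

[folklore] Jacobi's formula, the Euler operator `X ∂_X`, elementary `2 × 2` algebra.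
-/

-- `Summit.ValiantsHypothesis.ValiantsHypothesis.…` repeats a component by the D-0017 layout
-- (single-conjunct summit), which the `dupNamespace` linter flags; the name is mandated.
set_option linter.dupNamespace false

namespace Summit.ValiantsHypothesis.ValiantsHypothesis.Theorems.LacunarySymmetroidMatrixDescartes.Pivot.Deflation

open Polynomial Matrix Finset
open scoped BigOperators
open Summit.ValiantsHypothesis.ValiantsHypothesis.Theorems.LacunarySymmetroidMatrixDescartes.Pivot.Tangency

variable {K : ℕ}

/-! ## Elementary `2 × 2` facts -/

/-- **Sign transfer through the kernel.**  If `(x,y)` is in the kernel of the symmetric `[[a,b],[b,c]]`, then for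
ANY symmetric `[[a',b'],[b',c']]`: `(a + c)·(a'x² + 2b'xy + c'y²) = (a'c + ac' − 2bb')·(x² + y²)`. [folklore] -/
theorem kernel_form_eq (a b c a' b' c' x y : ℝ) (h1 : a * x + b * y = 0) (h2 : b * x + c * y = 0) :
    (a + c) * (a' * x ^ 2 + 2 * b' * x * y + c' * y ^ 2)
      = (a' * c + a * c' - 2 * b * b') * (x ^ 2 + y ^ 2) := by
  linear_combination (a' * x + 2 * b' * y - c' * x) * h1 + (c' * y + 2 * b' * x - a' * y) * h2

/-- `(a + c)(a x² + 2 b x y + c y²) = (a x + b y)² + (b x + c y)²` when `a c = b²`. [folklore] -/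
theorem singular_form_eq (a b c x y : ℝ) (hdet : a * c = b ^ 2) :
    (a + c) * (a * x ^ 2 + 2 * b * x * y + c * y ^ 2) = (a * x + b * y) ^ 2 + (b * x + c * y) ^ 2 := by
  linear_combination (x ^ 2 + y ^ 2) * hdet

/-- A symmetric `2 × 2` form with a strictly positive and a strictly negative value has `α γ − β² < 0`. -/
theorem det_neg_of_pos_of_neg (α β γ x y x' y' : ℝ) (hpos : 0 < α * x ^ 2 + 2 * β * x * y + γ * y ^ 2)
    (hneg : α * x' ^ 2 + 2 * β * x' * y' + γ * y' ^ 2 < 0) : α * γ - β ^ 2 < 0 := by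
  by_contra h
  rw [not_lt] at h
  rcases lt_trichotomy α 0 with hα | hα | hα
  · have key : α * (α * x ^ 2 + 2 * β * x * y + γ * y ^ 2)
        = (α * x + β * y) ^ 2 + (α * γ - β ^ 2) * y ^ 2 := by ring
    have : 0 ≤ α * (α * x ^ 2 + 2 * β * x * y + γ * y ^ 2) := by rw [key]; positivity
    nlinarith
  · have hβ : β = 0 := by
      have : β ^ 2 ≤ 0 := by rw [hα, zero_mul, zero_sub] at h; linarith
      exact pow_eq_zero_iff (n := 2) (by norm_num) |>.1 (le_antisymm this (sq_nonneg β))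
    rw [hα, hβ] at hpos hneg
    have hy : 0 < γ * y ^ 2 := by linarith
    have hy' : γ * y' ^ 2 < 0 := by linarith
    rcases lt_or_ge γ 0 with hγ | hγ
    · nlinarith [sq_nonneg y]
    · nlinarith [sq_nonneg y']
  · have key : α * (α * x' ^ 2 + 2 * β * x' * y' + γ * y' ^ 2)
        = (α * x' + β * y') ^ 2 + (α * γ - β ^ 2) * y' ^ 2 := by ring
    have : 0 ≤ α * (α * x' ^ 2 + 2 * β * x' * y' + γ * y' ^ 2) := by rw [key]; positivity
    nlinarith

/-- The quadratic form of a symmetric `2 × 2` matrix in coordinates. -/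
theorem quadForm_fin_two (M : Matrix (Fin 2) (Fin 2) ℝ) (hM : M 1 0 = M 0 1) (v : Fin 2 → ℝ) :
    dotProduct v (M.mulVec v) = M 0 0 * v 0 ^ 2 + 2 * M 0 1 * v 0 * v 1 + M 1 1 * v 1 ^ 2 := by
  simp only [Matrix.mulVec, dotProduct, Fin.sum_univ_two]
  rw [hM]; ring

/-- Quadratic form of a general `2 × 2` letter combination `s • J + ∑ₖ a k • P k`. -/
theorem quadForm_comb (s : ℝ) (a : Fin K → ℝ) (J : Matrix (Fin 2) (Fin 2) ℝ)
    (P : Fin K → Matrix (Fin 2) (Fin 2) ℝ) (w : Fin 2 → ℝ) :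
    dotProduct w ((s • J + ∑ k, a k • P k).mulVec w)
      = s * dotProduct w (J.mulVec w) + ∑ k, a k * dotProduct w ((P k).mulVec w) := by
  simp only [Matrix.add_mulVec, Matrix.smul_mulVec, dotProduct_add, dotProduct_smul, smul_eq_mul,
    Matrix.sum_mulVec, dotProduct_sum]

/-- Off-diagonal symmetry of a letter combination of symmetric matrices. -/
theorem comb_symm (s : ℝ) (a : Fin K → ℝ) (J : Matrix (Fin 2) (Fin 2) ℝ) (P : Fin K → Matrix (Fin 2) (Fin 2) ℝ)
    (hJ : J.IsSymm) (hP : ∀ k, (P k).IsSymm) :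
    (s • J + ∑ k, a k • P k) 1 0 = (s • J + ∑ k, a k • P k) 0 1 := by
  have h1 : J 1 0 = J 0 1 := by simpa using congrFun (congrFun hJ 0) 1
  have h2 : ∀ k, P k 1 0 = P k 0 1 := fun k => by simpa using congrFun (congrFun (hP k) 0) 1
  simp [Matrix.add_apply, Matrix.smul_apply, Matrix.sum_apply, h1, h2]

/-! ## Jacobi's derivative on the kernel vector; the trace at a root -/

/-- **Sign of the Jacobi derivative on the kernel.**  `J`, `P k` symmetric.  If `w` is a kernel vector of
`F(u₀) = u₀^e • J + ∑ u₀^{d k} • P k`, then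
`tr F(u₀) · wᵀ F'(u₀) w = (det F)'(u₀) · (w₀² + w₁²)`. [folklore: Jacobi's formula] -/
theorem trace_mul_quadForm_deriv_eq (e : ℕ) (d : Fin K → ℕ) (J : Matrix (Fin 2) (Fin 2) ℝ)
    (P : Fin K → Matrix (Fin 2) (Fin 2) ℝ) (hJ : J.IsSymm) (hP : ∀ k, (P k).IsSymm) (u₀ : ℝ)
    (w : Fin 2 → ℝ) (hw : (u₀ ^ e • J + ∑ k, u₀ ^ d k • P k).mulVec w = 0) :
    ((u₀ ^ e • J + ∑ k, u₀ ^ d k • P k) 0 0 + (u₀ ^ e • J + ∑ k, u₀ ^ d k • P k) 1 1)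
        * dotProduct w (((((e : ℕ) : ℝ) * u₀ ^ (e - 1)) • J + ∑ k, (((d k : ℕ) : ℝ) * u₀ ^ (d k - 1)) • P k).mulVec w)
      = (Polynomial.derivative (Matrix.det (((Polynomial.X : ℝ[X]) ^ e) • Matrix.map J Polynomial.C
          + ∑ k, ((Polynomial.X : ℝ[X]) ^ d k) • Matrix.map (P k) Polynomial.C))).eval u₀ * (w 0 ^ 2 + w 1 ^ 2) := by
  have hsymV : (u₀ ^ e • J + ∑ k, u₀ ^ d k • P k) 1 0 = (u₀ ^ e • J + ∑ k, u₀ ^ d k • P k) 0 1 := comb_symm (u₀ ^ e) (fun k => u₀ ^ d k) J P hJ hP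
  have hsymD : ((((e : ℕ) : ℝ) * u₀ ^ (e - 1)) • J + ∑ k, (((d k : ℕ) : ℝ) * u₀ ^ (d k - 1)) • P k) 1 0
      = ((((e : ℕ) : ℝ) * u₀ ^ (e - 1)) • J + ∑ k, (((d k : ℕ) : ℝ) * u₀ ^ (d k - 1)) • P k) 0 1 :=
    comb_symm (((e : ℕ) : ℝ) * u₀ ^ (e - 1)) (fun k => ((d k : ℕ) : ℝ) * u₀ ^ (d k - 1)) J P hJ hP
  rw [eval_derivative_det_pencil, quadForm_fin_two _ hsymD, hsymV, hsymD]
  have hk0 := congrFun hw 0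
  have hk1 := congrFun hw 1
  simp only [Matrix.mulVec, dotProduct, Fin.sum_univ_two, Pi.zero_apply] at hk0 hk1
  rw [hsymV] at hk1
  have := kernel_form_eq ((u₀ ^ e • J + ∑ k, u₀ ^ d k • P k) 0 0) ((u₀ ^ e • J + ∑ k, u₀ ^ d k • P k) 0 1)
    ((u₀ ^ e • J + ∑ k, u₀ ^ d k • P k) 1 1)
    (((((e : ℕ) : ℝ) * u₀ ^ (e - 1)) • J + ∑ k, (((d k : ℕ) : ℝ) * u₀ ^ (d k - 1)) • P k) 0 0)
    (((((e : ℕ) : ℝ) * u₀ ^ (e - 1)) • J + ∑ k, (((d k : ℕ) : ℝ) * u₀ ^ (d k - 1)) • P k) 0 1)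
    (((((e : ℕ) : ℝ) * u₀ ^ (e - 1)) • J + ∑ k, (((d k : ℕ) : ℝ) * u₀ ^ (d k - 1)) • P k) 1 1)
    (w 0) (w 1) (by linarith [hk0]) (by linarith [hk1])
  linear_combination this

/-- **Positive trace at a root.**  If every `P k ⪰ 0`, `J` (symmetric) has a strictly positive direction and
`u₀ > 0` is a root of `det F`, then `tr F(u₀) > 0` (else `J ⪯ 0`). [folklore] -/
theorem trace_pos_at_root (e : ℕ) (d : Fin K → ℕ) (J : Matrix (Fin 2) (Fin 2) ℝ)
    (P : Fin K → Matrix (Fin 2) (Fin 2) ℝ) (hJ : J.IsSymm) (hP : ∀ k, (P k).PosSemidef)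
    (hJpos : ∃ x : Fin 2 → ℝ, 0 < dotProduct x (J.mulVec x)) (u₀ : ℝ) (hu₀ : 0 < u₀)
    (hroot : (Matrix.det (((Polynomial.X : ℝ[X]) ^ e) • Matrix.map J Polynomial.C
          + ∑ k, ((Polynomial.X : ℝ[X]) ^ d k) • Matrix.map (P k) Polynomial.C)).eval u₀ = 0) :
    0 < (u₀ ^ e • J + ∑ k, u₀ ^ d k • P k) 0 0 + (u₀ ^ e • J + ∑ k, u₀ ^ d k • P k) 1 1 := by
  obtain ⟨x, hx⟩ := hJpos
  have hPs : ∀ k, (P k).IsSymm := fun k => by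
    have h := (hP k).isHermitian
    unfold Matrix.IsHermitian at h
    rwa [Matrix.conjTranspose_eq_transpose_of_trivial] at h
  have hsymV : (u₀ ^ e • J + ∑ k, u₀ ^ d k • P k) 1 0 = (u₀ ^ e • J + ∑ k, u₀ ^ d k • P k) 0 1 := comb_symm (u₀ ^ e) (fun k => u₀ ^ d k) J P hJ hPs
  have hFx : 0 < dotProduct x ((u₀ ^ e • J + ∑ k, u₀ ^ d k • P k).mulVec x) := by
    rw [quadForm_comb]
    have hsum : 0 ≤ ∑ k, u₀ ^ d k * dotProduct x ((P k).mulVec x) :=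
      Finset.sum_nonneg fun k _ => mul_nonneg (pow_nonneg hu₀.le _) (by simpa only [star_trivial] using (hP k).dotProduct_mulVec_nonneg x)
    have : 0 < u₀ ^ e * dotProduct x (J.mulVec x) := mul_pos (pow_pos hu₀ _) hx
    linarith
  rw [quadForm_fin_two _ hsymV] at hFx
  rw [eval_det_pencil, hsymV] at hroot
  set a := (u₀ ^ e • J + ∑ k, u₀ ^ d k • P k) 0 0
  set b := (u₀ ^ e • J + ∑ k, u₀ ^ d k • P k) 0 1
  set c := (u₀ ^ e • J + ∑ k, u₀ ^ d k • P k) 1 1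
  have hdet : a * c = b ^ 2 := by linarith [hroot]
  have key := singular_form_eq a b c (x 0) (x 1) hdet
  by_contra hle
  rw [not_lt] at hle
  have hle' : (a + c) * (a * x 0 ^ 2 + 2 * b * x 0 * x 1 + c * x 1 ^ 2) ≤ 0 :=
    mul_nonpos_of_nonpos_of_nonneg hle hFx.le
  rw [key] at hle'
  have e1 : a * x 0 + b * x 1 = 0 := by
    nlinarith [sq_nonneg (a * x 0 + b * x 1), sq_nonneg (b * x 0 + c * x 1)]
  have e2 : b * x 0 + c * x 1 = 0 := by
    nlinarith [sq_nonneg (a * x 0 + b * x 1), sq_nonneg (b * x 0 + c * x 1)]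
  have : a * x 0 ^ 2 + 2 * b * x 0 * x 1 + c * x 1 ^ 2 = 0 := by
    linear_combination (x 0) * e1 + (x 1) * e2
  linarith

/-- At a root, `u₀ · wᵀ F'(u₀) w` splits letter by letter:
`u₀ · wᵀ F'(u₀) w = e u₀^e wᵀJw + ∑ (d k) u₀^{d k} wᵀP_kw`. -/
theorem mul_quadForm_deriv (e : ℕ) (d : Fin K → ℕ) (J : Matrix (Fin 2) (Fin 2) ℝ)
    (P : Fin K → Matrix (Fin 2) (Fin 2) ℝ) (u₀ : ℝ) (w : Fin 2 → ℝ) :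
    u₀ * dotProduct w (((((e : ℕ) : ℝ) * u₀ ^ (e - 1)) • J + ∑ k, (((d k : ℕ) : ℝ) * u₀ ^ (d k - 1)) • P k).mulVec w)
      = ((e : ℕ) : ℝ) * u₀ ^ e * dotProduct w (J.mulVec w)
        + ∑ k, (((d k : ℕ) : ℝ) * u₀ ^ d k) * dotProduct w ((P k).mulVec w) := by
  rw [quadForm_comb, mul_add, Finset.mul_sum, ← mul_assoc, SecularRolle.mul_natCast_mul_pow_pred]
  congr 1
  refine Finset.sum_congr rfl fun k _ => ?_
  rw [← mul_assoc, SecularRolle.mul_natCast_mul_pow_pred]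

/-! ## Deflation nesting -/

/-- **DEFLATION NESTING, TOP LETTER.**  `F(X) = X^e • J + ∑ₖ X^{d k} • P k` with `J` symmetric having a
strictly positive direction and every `P k ⪰ 0`; let `i₀` be a letter of maximal exponent with `e < d i₀`, and
let the TOP-DEFLATED pencil be `F̃(X) = X^e • J + ∑ₖ ((d i₀ − d k)/(d i₀ − e)) X^{d k} • P k` (non-negative
rescaling; the letter `i₀` drops out; `(X ∂_X − d i₀) F = −(d i₀ − e) F̃`).  If `u₀ > 0` is a root of `det F`
at which `det F` is strictly INCREASING (`(det F)'(u₀) > 0`: the right end-point of an island `{det F < 0}`),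
then `det F̃(u₀) < 0`: every up-crossing of the `K`-letter pencil lies inside an island of its top deflation.
Kernel form of the scalar inequality `Λ̃_{K−1} ≤ Λ_K − Λ_K'/b_K`. [folklore: Jacobi's formula + Euler operator] -/
theorem det_deflateTop_neg_of_upcrossing (e : ℕ) (d : Fin K → ℕ) (J : Matrix (Fin 2) (Fin 2) ℝ)
    (P : Fin K → Matrix (Fin 2) (Fin 2) ℝ) (hJ : J.IsSymm) (hP : ∀ k, (P k).PosSemidef)
    (hJpos : ∃ x : Fin 2 → ℝ, 0 < dotProduct x (J.mulVec x)) (i₀ : Fin K) (htop : ∀ k, d k ≤ d i₀)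
    (he : e < d i₀) (u₀ : ℝ) (hu₀ : 0 < u₀)
    (hroot : (Matrix.det (((Polynomial.X : ℝ[X]) ^ e) • Matrix.map J Polynomial.C
          + ∑ k, ((Polynomial.X : ℝ[X]) ^ d k) • Matrix.map (P k) Polynomial.C)).eval u₀ = 0)
    (hup : 0 < (Polynomial.derivative (Matrix.det (((Polynomial.X : ℝ[X]) ^ e) • Matrix.map J Polynomial.C
          + ∑ k, ((Polynomial.X : ℝ[X]) ^ d k) • Matrix.map (P k) Polynomial.C))).eval u₀) :
    (u₀ ^ e • J + ∑ k, ((((d i₀ : ℕ) : ℝ) - d k) / (((d i₀ : ℕ) : ℝ) - e) * u₀ ^ d k) • P k).det < 0 := by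
  have hPs : ∀ k, (P k).IsSymm := fun k => by
    have h := (hP k).isHermitian
    unfold Matrix.IsHermitian at h
    rwa [Matrix.conjTranspose_eq_transpose_of_trivial] at h
  have hgap : (0 : ℝ) < ((d i₀ : ℕ) : ℝ) - e := sub_pos.2 (by exact_mod_cast he)
  have hsymV : (u₀ ^ e • J + ∑ k, u₀ ^ d k • P k) 1 0 = (u₀ ^ e • J + ∑ k, u₀ ^ d k • P k) 0 1 := comb_symm (u₀ ^ e) (fun k => u₀ ^ d k) J P hJ hPs
  -- a non-zero kernel vector of F(u₀)
  have hdet0 : (u₀ ^ e • J + ∑ k, u₀ ^ d k • P k).det = 0 := by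
    have h := hroot
    rw [eval_det_pencil] at h
    rw [Matrix.det_fin_two]; linarith
  obtain ⟨w, hw0, hw⟩ := Matrix.exists_mulVec_eq_zero_iff.2 hdet0
  have hw2 : 0 < w 0 ^ 2 + w 1 ^ 2 := by
    by_contra hle
    rw [not_lt] at hle
    apply hw0
    have h0 : w 0 = 0 := by nlinarith [sq_nonneg (w 0), sq_nonneg (w 1)]
    have h1' : w 1 = 0 := by nlinarith [sq_nonneg (w 0), sq_nonneg (w 1)]
    ext i; fin_cases i <;> assumption
  -- wᵀ F'(u₀) w > 0 (Jacobi + positive trace)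
  have htr := trace_pos_at_root e d J P hJ hP hJpos u₀ hu₀ hroot
  have hjac := trace_mul_quadForm_deriv_eq e d J P hJ hPs u₀ w hw
  have hDpos : 0 < dotProduct w (((((e : ℕ) : ℝ) * u₀ ^ (e - 1)) • J
      + ∑ k, (((d k : ℕ) : ℝ) * u₀ ^ (d k - 1)) • P k).mulVec w) := by
    have h1 : 0 < (Polynomial.derivative (Matrix.det (((Polynomial.X : ℝ[X]) ^ e) • Matrix.map J Polynomial.C
          + ∑ k, ((Polynomial.X : ℝ[X]) ^ d k) • Matrix.map (P k) Polynomial.C))).eval u₀ * (w 0 ^ 2 + w 1 ^ 2) :=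
      mul_pos hup hw2
    rw [← hjac] at h1
    exact pos_of_mul_pos_right h1 htr.le
  -- the quadratic form of the deflated pencil on w is negative
  have hFw : dotProduct w ((u₀ ^ e • J + ∑ k, u₀ ^ d k • P k).mulVec w) = 0 := by
    rw [hw, dotProduct_zero]
  rw [quadForm_comb] at hFw
  have hD := mul_quadForm_deriv e d J P u₀ w
  have hneg : dotProduct w ((u₀ ^ e • J
      + ∑ k, ((((d i₀ : ℕ) : ℝ) - d k) / (((d i₀ : ℕ) : ℝ) - e) * u₀ ^ d k) • P k).mulVec w) < 0 := by
    rw [quadForm_comb]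
    -- (d i₀ − e) · form = d i₀ · (wᵀFw) − u₀ · (wᵀF'w)
    have key : (((d i₀ : ℕ) : ℝ) - e) * (u₀ ^ e * dotProduct w (J.mulVec w)
        + ∑ k, ((((d i₀ : ℕ) : ℝ) - d k) / (((d i₀ : ℕ) : ℝ) - e) * u₀ ^ d k) * dotProduct w ((P k).mulVec w))
        = ((d i₀ : ℕ) : ℝ) * (u₀ ^ e * dotProduct w (J.mulVec w) + ∑ k, u₀ ^ d k * dotProduct w ((P k).mulVec w))
          - (((e : ℕ) : ℝ) * u₀ ^ e * dotProduct w (J.mulVec w)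
            + ∑ k, (((d k : ℕ) : ℝ) * u₀ ^ d k) * dotProduct w ((P k).mulVec w)) := by
      have hterm : ∀ k, (((d i₀ : ℕ) : ℝ) - e)
          * (((((d i₀ : ℕ) : ℝ) - d k) / (((d i₀ : ℕ) : ℝ) - e) * u₀ ^ d k) * dotProduct w ((P k).mulVec w))
          = ((d i₀ : ℕ) : ℝ) * (u₀ ^ d k * dotProduct w ((P k).mulVec w))
            - (((d k : ℕ) : ℝ) * u₀ ^ d k) * dotProduct w ((P k).mulVec w) := by
        intro k
        field_simp
      rw [mul_add, Finset.mul_sum, Finset.sum_congr rfl fun k _ => hterm k, Finset.sum_sub_distrib,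
        ← Finset.mul_sum]
      ring
    have hval : (((d i₀ : ℕ) : ℝ) - e) * (u₀ ^ e * dotProduct w (J.mulVec w)
        + ∑ k, ((((d i₀ : ℕ) : ℝ) - d k) / (((d i₀ : ℕ) : ℝ) - e) * u₀ ^ d k) * dotProduct w ((P k).mulVec w))
        < 0 := by
      rw [key, hFw, mul_zero, zero_sub, ← hD]
      have : 0 < u₀ * dotProduct w (((((e : ℕ) : ℝ) * u₀ ^ (e - 1)) • J
        + ∑ k, (((d k : ℕ) : ℝ) * u₀ ^ (d k - 1)) • P k).mulVec w) := mul_pos hu₀ hDpos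
      linarith
    -- (positive) · form < 0 ⇒ form < 0
    by_contra hge
    rw [not_lt] at hge
    have := mul_nonneg hgap.le hge
    linarith
  -- a positive direction for the deflated pencil: xᵀ F̃ x ≥ u₀^e xᵀJx > 0
  obtain ⟨x, hx⟩ := hJpos
  have hpos : 0 < dotProduct x ((u₀ ^ e • J
      + ∑ k, ((((d i₀ : ℕ) : ℝ) - d k) / (((d i₀ : ℕ) : ℝ) - e) * u₀ ^ d k) • P k).mulVec x) := by
    rw [quadForm_comb]
    have hsum : 0 ≤ ∑ k, ((((d i₀ : ℕ) : ℝ) - d k) / (((d i₀ : ℕ) : ℝ) - e) * u₀ ^ d k)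
        * dotProduct x ((P k).mulVec x) := by
      refine Finset.sum_nonneg fun k _ => mul_nonneg (mul_nonneg (div_nonneg ?_ hgap.le) (pow_nonneg hu₀.le _)) (by simpa only [star_trivial] using (hP k).dotProduct_mulVec_nonneg x)
      have : ((d k : ℕ) : ℝ) ≤ ((d i₀ : ℕ) : ℝ) := by exact_mod_cast htop k
      linarith
    have : 0 < u₀ ^ e * dotProduct x (J.mulVec x) := mul_pos (pow_pos hu₀ _) hx
    linarith
  -- indefinite ⇒ det < 0
  have hsymT : (u₀ ^ e • J
      + ∑ k, ((((d i₀ : ℕ) : ℝ) - d k) / (((d i₀ : ℕ) : ℝ) - e) * u₀ ^ d k) • P k) 1 0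
      = (u₀ ^ e • J
      + ∑ k, ((((d i₀ : ℕ) : ℝ) - d k) / (((d i₀ : ℕ) : ℝ) - e) * u₀ ^ d k) • P k) 0 1 :=
    comb_symm (u₀ ^ e) (fun k => (((d i₀ : ℕ) : ℝ) - d k) / (((d i₀ : ℕ) : ℝ) - e) * u₀ ^ d k) J P hJ hPs
  rw [quadForm_fin_two _ hsymT] at hpos hneg
  rw [Matrix.det_fin_two, hsymT]
  have := det_neg_of_pos_of_neg _ _ _ _ _ _ _ hpos hneg
  nlinarith [this]

/-- **DEFLATION NESTING, BOTTOM LETTER.**  Same setting; let `i₀` be a letter of minimal exponent with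
`d i₀ < e`, and let the BOTTOM-DEFLATED pencil be `F̃(X) = X^e • J + ∑ₖ ((d k − d i₀)/(e − d i₀)) X^{d k} • P k`
(`(X ∂_X − d i₀) F = (e − d i₀) F̃`).  If `u₀ > 0` is a root of `det F` at which `det F` is strictly DECREASING
(`(det F)'(u₀) < 0`: the left end-point of an island `{det F < 0}`), then `det F̃(u₀) < 0`: every down-crossing
of the `K`-letter pencil lies inside an island of its bottom deflation. [folklore] -/
theorem det_deflateBot_neg_of_downcrossing (e : ℕ) (d : Fin K → ℕ) (J : Matrix (Fin 2) (Fin 2) ℝ)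
    (P : Fin K → Matrix (Fin 2) (Fin 2) ℝ) (hJ : J.IsSymm) (hP : ∀ k, (P k).PosSemidef)
    (hJpos : ∃ x : Fin 2 → ℝ, 0 < dotProduct x (J.mulVec x)) (i₀ : Fin K) (hbot : ∀ k, d i₀ ≤ d k)
    (he : d i₀ < e) (u₀ : ℝ) (hu₀ : 0 < u₀)
    (hroot : (Matrix.det (((Polynomial.X : ℝ[X]) ^ e) • Matrix.map J Polynomial.C
          + ∑ k, ((Polynomial.X : ℝ[X]) ^ d k) • Matrix.map (P k) Polynomial.C)).eval u₀ = 0)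
    (hdown : (Polynomial.derivative (Matrix.det (((Polynomial.X : ℝ[X]) ^ e) • Matrix.map J Polynomial.C
          + ∑ k, ((Polynomial.X : ℝ[X]) ^ d k) • Matrix.map (P k) Polynomial.C))).eval u₀ < 0) :
    (u₀ ^ e • J + ∑ k, ((((d k : ℕ) : ℝ) - d i₀) / ((e : ℝ) - d i₀) * u₀ ^ d k) • P k).det < 0 := by
  have hPs : ∀ k, (P k).IsSymm := fun k => by
    have h := (hP k).isHermitian
    unfold Matrix.IsHermitian at h
    rwa [Matrix.conjTranspose_eq_transpose_of_trivial] at h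
  have hgap : (0 : ℝ) < (e : ℝ) - d i₀ := sub_pos.2 (by exact_mod_cast he)
  -- a non-zero kernel vector of F(u₀)
  have hdet0 : (u₀ ^ e • J + ∑ k, u₀ ^ d k • P k).det = 0 := by
    have hsymV : (u₀ ^ e • J + ∑ k, u₀ ^ d k • P k) 1 0 = (u₀ ^ e • J + ∑ k, u₀ ^ d k • P k) 0 1 :=
      comb_symm (u₀ ^ e) (fun k => u₀ ^ d k) J P hJ hPs
    have h := hroot
    rw [eval_det_pencil] at h
    rw [Matrix.det_fin_two]; linarith
  obtain ⟨w, hw0, hw⟩ := Matrix.exists_mulVec_eq_zero_iff.2 hdet0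
  have hw2 : 0 < w 0 ^ 2 + w 1 ^ 2 := by
    by_contra hle
    rw [not_lt] at hle
    apply hw0
    have h0 : w 0 = 0 := by nlinarith [sq_nonneg (w 0), sq_nonneg (w 1)]
    have h1' : w 1 = 0 := by nlinarith [sq_nonneg (w 0), sq_nonneg (w 1)]
    ext i; fin_cases i <;> assumption
  -- wᵀ F'(u₀) w < 0 (Jacobi + positive trace)
  have htr := trace_pos_at_root e d J P hJ hP hJpos u₀ hu₀ hroot
  have hjac := trace_mul_quadForm_deriv_eq e d J P hJ hPs u₀ w hw
  have hDneg : dotProduct w (((((e : ℕ) : ℝ) * u₀ ^ (e - 1)) • J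
      + ∑ k, (((d k : ℕ) : ℝ) * u₀ ^ (d k - 1)) • P k).mulVec w) < 0 := by
    have h1 : (Polynomial.derivative (Matrix.det (((Polynomial.X : ℝ[X]) ^ e) • Matrix.map J Polynomial.C
          + ∑ k, ((Polynomial.X : ℝ[X]) ^ d k) • Matrix.map (P k) Polynomial.C))).eval u₀ * (w 0 ^ 2 + w 1 ^ 2) < 0 :=
      mul_neg_of_neg_of_pos hdown hw2
    rw [← hjac] at h1
    by_contra hge
    rw [not_lt] at hge
    have := mul_nonneg htr.le hge
    linarith
  -- the quadratic form of the deflated pencil on w is negative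
  have hFw : dotProduct w ((u₀ ^ e • J + ∑ k, u₀ ^ d k • P k).mulVec w) = 0 := by
    rw [hw, dotProduct_zero]
  rw [quadForm_comb] at hFw
  have hD := mul_quadForm_deriv e d J P u₀ w
  have hneg : dotProduct w ((u₀ ^ e • J
      + ∑ k, ((((d k : ℕ) : ℝ) - d i₀) / ((e : ℝ) - d i₀) * u₀ ^ d k) • P k).mulVec w) < 0 := by
    rw [quadForm_comb]
    -- (e − d i₀) · form = u₀ · (wᵀF'w) − d i₀ · (wᵀFw)
    have key : ((e : ℝ) - d i₀) * (u₀ ^ e * dotProduct w (J.mulVec w)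
        + ∑ k, ((((d k : ℕ) : ℝ) - d i₀) / ((e : ℝ) - d i₀) * u₀ ^ d k) * dotProduct w ((P k).mulVec w))
        = (((e : ℕ) : ℝ) * u₀ ^ e * dotProduct w (J.mulVec w)
            + ∑ k, (((d k : ℕ) : ℝ) * u₀ ^ d k) * dotProduct w ((P k).mulVec w))
          - ((d i₀ : ℕ) : ℝ) * (u₀ ^ e * dotProduct w (J.mulVec w) + ∑ k, u₀ ^ d k * dotProduct w ((P k).mulVec w)) := by
      have hterm : ∀ k, ((e : ℝ) - d i₀)
          * (((((d k : ℕ) : ℝ) - d i₀) / ((e : ℝ) - d i₀) * u₀ ^ d k) * dotProduct w ((P k).mulVec w))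
          = (((d k : ℕ) : ℝ) * u₀ ^ d k) * dotProduct w ((P k).mulVec w)
            - ((d i₀ : ℕ) : ℝ) * (u₀ ^ d k * dotProduct w ((P k).mulVec w)) := by
        intro k
        field_simp
      rw [mul_add, Finset.mul_sum, Finset.sum_congr rfl fun k _ => hterm k, Finset.sum_sub_distrib,
        ← Finset.mul_sum]
      ring
    have hval : ((e : ℝ) - d i₀) * (u₀ ^ e * dotProduct w (J.mulVec w)
        + ∑ k, ((((d k : ℕ) : ℝ) - d i₀) / ((e : ℝ) - d i₀) * u₀ ^ d k) * dotProduct w ((P k).mulVec w))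
        < 0 := by
      rw [key, hFw, mul_zero, sub_zero, ← hD]
      exact mul_neg_of_pos_of_neg hu₀ hDneg
    by_contra hge
    rw [not_lt] at hge
    have := mul_nonneg hgap.le hge
    linarith
  -- a positive direction for the deflated pencil
  obtain ⟨x, hx⟩ := hJpos
  have hpos : 0 < dotProduct x ((u₀ ^ e • J
      + ∑ k, ((((d k : ℕ) : ℝ) - d i₀) / ((e : ℝ) - d i₀) * u₀ ^ d k) • P k).mulVec x) := by
    rw [quadForm_comb]
    have hsum : 0 ≤ ∑ k, ((((d k : ℕ) : ℝ) - d i₀) / ((e : ℝ) - d i₀) * u₀ ^ d k)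
        * dotProduct x ((P k).mulVec x) := by
      refine Finset.sum_nonneg fun k _ => mul_nonneg (mul_nonneg (div_nonneg ?_ hgap.le) (pow_nonneg hu₀.le _))
        (by simpa only [star_trivial] using (hP k).dotProduct_mulVec_nonneg x)
      have : ((d i₀ : ℕ) : ℝ) ≤ ((d k : ℕ) : ℝ) := by exact_mod_cast hbot k
      linarith
    have : 0 < u₀ ^ e * dotProduct x (J.mulVec x) := mul_pos (pow_pos hu₀ _) hx
    linarith
  -- indefinite ⇒ det < 0
  have hsymT : (u₀ ^ e • J
      + ∑ k, ((((d k : ℕ) : ℝ) - d i₀) / ((e : ℝ) - d i₀) * u₀ ^ d k) • P k) 1 0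
      = (u₀ ^ e • J
      + ∑ k, ((((d k : ℕ) : ℝ) - d i₀) / ((e : ℝ) - d i₀) * u₀ ^ d k) • P k) 0 1 :=
    comb_symm (u₀ ^ e) (fun k => (((d k : ℕ) : ℝ) - d i₀) / ((e : ℝ) - d i₀) * u₀ ^ d k) J P hJ hPs
  rw [quadForm_fin_two _ hsymT] at hpos hneg
  rw [Matrix.det_fin_two, hsymT]
  have := det_neg_of_pos_of_neg _ _ _ _ _ _ _ hpos hneg
  nlinarith [this]

end Summit.ValiantsHypothesis.ValiantsHypothesis.Theorems.LacunarySymmetroidMatrixDescartes.Pivot.Deflation
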